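import Literature.Computability.QuantumComplexity.Forrelation
import Literature.Computability.Cryptography.ClassBQP
import HarnessLib

/-!
# Named fact: explicit poly-fold Forrelation is `PromiseBQP`-complete (Aaronson–Ambainis)

Topic `Literature/Computability/QuantumComplexity`; cite item `wi-03712` (routes
QuantumAdvantage/PromiseLift crux #4, AvgCase crux #4), over the tree's `kForrelationProblem`
(`Forrelation.lean`) and `PromiseBQP` (`ClassBQP.lean`).

**Aaronson–Ambainis 2018** (SIAM J. Comput. 47; arXiv:1411.5729), §1.2 / §1.1.3 with Thm. 5, and
§6 (Prop. 6, Thm. 25): (i) `k`-fold FORRELATION is solvable by a quantum algorithm making `⌈k/2⌉`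
queries — in the white-box setting (the `fᵢ` given by circuits `C₁, …, C_k`) this puts explicit
`k`-fold Forrelation, for ALL `k`, in `PromiseBQP` (simulate each query by running the circuit);
(ii) for `k = poly(n)`, explicit `k`-fold Forrelation is `PromiseBQP`-hard under Karp (many-one,
promise-preserving) reductions: any `m`-gate quantum circuit over the universal basis
{Hadamard, Toffoli/CCZ-type} is rewritten as alternating Hadamard layers and `±1` phase oracles
computed by small classical circuits, so that its acceptance statistic becomes a forrelation
value on the right side of the `3/5` vs `1/100` gap.

Rendering. The tree's `kForrelationProblem` has `k` as part of the instance (all `k` at once), so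
(i) is membership of the whole problem in `PromiseBQP` and (ii) is hardness of the whole problem
(the reduction lands in the `k = poly(n)` slice by itself): every `Q ∈ PromiseBQP` Karp-reduces to
it (`PromiseProblem.PolyTimeReducible`, `Promise.lean`). The tree's `PromiseBQP` is the uniform
Clifford+`T` rendering (thresholds `2/3`, `1/3`); Aaronson–Ambainis work with Hadamard+Toffoli,
an equivalent universal basis (Shi 2003) — the usual robustness of `BQP`, part of the cited claim.
Nothing is asserted; users take `(h : aaronson_ambainis_kForrelation_complete)`.

## References

* S. Aaronson, A. Ambainis, *Forrelation: a problem that optimally separates quantum from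
  classical computing*, SIAM J. Comput. 47 (2018) 982–1038: §1.2, §1.1.3 (Thm. 5), §6 (Prop. 6,
  Thm. 25).
* Y. Shi, *Both Toffoli and controlled-NOT need little help to do universal quantum computing*,
  QIC 3 (2003) (Hadamard + Toffoli is universal).
-/

noncomputable section

open Literature.Computability.Complexity Literature.Computability.Cryptography

namespace Literature.Computability.QuantumComplexity

/-- NAMED FACT (**Aaronson–Ambainis 2018, §1.2; §6, Prop. 6 and Thm. 25**): explicit `k`-fold
Forrelation (`kForrelationProblem`: `B₂`-circuits `C₁,…,C_k`, `Φ ≥ 3/5` vs `|Φ| ≤ 1/100`, `k` part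
of the input) is (i) in `PromiseBQP` and (ii) `PromiseBQP`-hard under polynomial-time Karp
reductions of promise problems — i.e. `PromiseBQP`-complete (hardness via the `k = poly(n)`
slice). Users take `(h : aaronson_ambainis_kForrelation_complete)`.
[Aaronson–Ambainis 2018, §1.2 (statement), §1.1.3 Thm. 5, §6 Prop. 6 and Thm. 25 (proofs)] [cite: AaronsonAmbainis2018, §1.2 and §6 (Prop. 6, Thm. 25)] -/
def aaronson_ambainis_kForrelation_complete : Prop :=
  kForrelationProblem ∈ PromiseBQP ∧
    ∀ Q ∈ PromiseBQP, PromiseProblem.PolyTimeReducible Q kForrelationProblem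

/-! ### API -/

/-- The membership half. [Aaronson–Ambainis 2018, §6 Prop. 6] [folklore] -/
theorem kForrelationProblem_mem_PromiseBQP (h : aaronson_ambainis_kForrelation_complete) :
    kForrelationProblem ∈ PromiseBQP :=
  h.1

/-- The hardness half, in the shape consumed by the PromiseLift route: every `PromiseBQP` problem
Karp-reduces to explicit poly-fold Forrelation. [Aaronson–Ambainis 2018, §6 Thm. 25] [folklore] -/
theorem polyTimeReducible_kForrelationProblem (h : aaronson_ambainis_kForrelation_complete)
    {Q : PromiseProblem} (hQ : Q ∈ PromiseBQP) :
    PromiseProblem.PolyTimeReducible Q kForrelationProblem :=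
  h.2 Q hQ

/-- In particular explicit poly-fold Forrelation reduces to itself (sanity: the reducibility
notion is reflexive, `PolyTimeReducible.refl`). [folklore] -/
example : PromiseProblem.PolyTimeReducible kForrelationProblem kForrelationProblem :=
  PromiseProblem.PolyTimeReducible.refl _

end Literature.Computability.QuantumComplexity
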